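import Summits.BirchSwinnertonDyer.BirchSwinnertonDyer.Theorems.ByReductionTypeAtTwoMultTransportTwistedDescentTateLine
import Summits.BirchSwinnertonDyer.BirchSwinnertonDyer.Theorems.ByReductionTypeAtTwoMultTransportTwistedDescentResOntoInvariants
import Summits.BirchSwinnertonDyer.BirchSwinnertonDyer.Theorems.ByReductionTypeAtTwoMultTransportTwistedDescentLocalGenerator
import Literature.NumberTheory.GaloisRepresentations.ConjugationDescent
import HarnessLib

/-!
# T-42-mult in the kernel, XXXV: the twisted quotient class of a `ψ_u`-Kummer class EXTENDS from
# `G_K = Gal(ℚ̄_2/ℚ_{2,∞})` to `Γ_{ℚ_2}` (bricks (b)–(d) of `T2`)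

Cell `bsd-2adic` (run/shared/lean/pub/bsd-2adic/), seat `bsd-2adic-t42` (BRIEF-T42), GEN 17. HONEST FRAMING:
research route; THEOREMS ONLY (no `def`, no named fact, no instance); nothing booked; BSD is not proved by any of
this. PARTITION: X5@2 multiplicative GV-transport rows (K4ᵐ B1·O1; the LOCAL statement `T2` at `2`, last open input of
`hF3b` after XXX) × p = 2 — types-the-object-of; bears_on K4 items 19922 / 19923
(`--supports stmt-BirchSwinnertonDyer-19923`). HOME/t42/DESIGN-T42-ADDENDUM-18.md §A18.3 (b)(c)(d).

## What

`F = ℚ_v` (`v ∋ 2`), `Γ = Γ_F`, `G_K = (ker κ)_v`, `κ` cyclotomic, `γ̃ ∈ Γ` with `κ(res γ̃) = 1` (XXXIV), `J ≥ 1`, `u` odd,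
`R = E[2^J](χ_u)|_Γ`, `C = C_J ⊆ E[2^J]` the Tate line (XXVIII), `D = R / C` (`ContinuousRep.quotient`). INPUT: a continuous
crossed homomorphism `g : G_K → E[2^J]` (plain action — the twist is invisible on `G_K`) and `m₀ ∈ E[2^J]` with
`(u·γ̃ g(γ̃⁻¹τγ̃) − g(τ)) − (τm₀ − m₀) ∈ C` on `G_K` (this is what XXXII (iii) makes of the hypothesis «`ψ_u c` is Kummer at
`v`»). OUTPUT (`exists_cocycle_quotient_extend`): a continuous crossed homomorphism `ξ : Γ → D` for the twisted action and
`d ∈ D` with `ξ(τ) = ḡ(τ) + (τd − d)` on `G_K` (`ḡ = g mod C`): the class of `ḡ` extends to `Γ`. Steps: `ḡ` is a cocycle of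
`G_K` (§1); its class is fixed by `conjMap γ̃` (the twisted conjugate of `ḡ` is `u·γ̃ḡ(γ̃⁻¹·γ̃) = ḡ + ∂(m₀ mod C)`) and by
`G_K` (`conjMap_eq_self_of_mem_one`), hence by all of `Γ` (the stabiliser is an open subgroup containing `G_K` and `γ̃`, and
`κ∘res` maps `cl⟨γ̃⟩` onto `ℤ_2`, `exists_mem_closure_zpowers_kappa_eq`); then XXXIII with `cd_2(Γ/G_K) ≤ 1` (XXXIV).

References: [GreenbergLNM1716] §4 pp. 107, 124 («`𝒫^Σ(M, F) → 𝒫^Σ(M, F_∞)^Γ` is surjective»); [NeukirchSchmidtWingberg2008]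
(1.6.7); [SerreGaloisCohomology1997] I §2.6 (b), I §3.4.
-/

set_option autoImplicit false
set_option linter.dupNamespace false

noncomputable section

open scoped Classical AddSubgroup

namespace Summit.BirchSwinnertonDyer.BirchSwinnertonDyer.Theorems.MultTransportTwistedDescent

open NumberField IsDedekindDomain Field WeierstrassCurve CategoryTheory Function
  Literature.NumberTheory.GaloisRepresentations Literature.NumberTheory.EllipticCurves
  Literature.NumberTheory.EllipticCurves.GreenbergSelmer IsDedekindDomain.HeightOneSpectrum Literature.GroupTheory
  ContinuousCohomology

variable (W : WeierstrassCurve ℚ) (κ : ZpExtension ℚ 2) {v : HeightOneSpectrum (𝓞 ℚ)}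
  (J : ℕ) (u : ℤ) (hu : (2 : ℤ) ∣ u - 1)
  (C : Submodule ℤ (W.geomTorsion ((2 ^ J : ℕ) : ℤ)))

/-- **The twisted quotient class extends from `G_K` to `Γ_{ℚ_v}`** (see the module docstring for the statement and
the proof). [cite: GreenbergLNM1716, §4 pp. 107, 124] [cite: NeukirchSchmidtWingberg2008, (1.6.7)] -/
theorem exists_cocycle_quotient_extend (hκ : κ.IsCyclotomic) (hv2 : ((2 : ℕ) : 𝓞 ℚ) ∈ v.asIdeal)
    [hNn : (localSubgroup κ.kerSubgroup (v.adicCompletion ℚ)).Normal]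
    (γt : absoluteGaloisGroup (v.adicCompletion ℚ))
    (hγt : κ (resGal (K := ℚ) (v.adicCompletion ℚ) γt) = Multiplicative.ofAdd 1)
    (g : localSubgroup κ.kerSubgroup (v.adicCompletion ℚ) → W.geomTorsion ((2 ^ J : ℕ) : ℤ))
    (hgcont : Continuous g)
    (hgcoc : ∀ τ₁ τ₂, g (τ₁ * τ₂) = g τ₁ + absGaloisRestrict ℚ (v.adicCompletion ℚ)
      (τ₁ : absoluteGaloisGroup (v.adicCompletion ℚ)) • g τ₂)
    (m₀ : W.geomTorsion ((2 ^ J : ℕ) : ℤ))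
    (hm₀ : ∀ τ : localSubgroup κ.kerSubgroup (v.adicCompletion ℚ),
      (u • (absGaloisRestrict ℚ (v.adicCompletion ℚ) γt •
        g (subgroupConj (localSubgroup κ.kerSubgroup (v.adicCompletion ℚ)) γt τ)) - g τ) -
        (absGaloisRestrict ℚ (v.adicCompletion ℚ) (τ : absoluteGaloisGroup (v.adicCompletion ℚ)) • m₀ - m₀) ∈ C)
    (hCstab : ∀ σ, C ≤ C.comap
      (((W.twistedTorsionGaloisModule 2 κ J u hu).restrict (absGaloisRestrict ℚ (v.adicCompletion ℚ))) σ)) :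
    ∃ (ξ : contOneCocycles (((W.twistedTorsionGaloisModule 2 κ J u hu).restrict
        (absGaloisRestrict ℚ (v.adicCompletion ℚ))).quotient C hCstab).toTopRep)
      (d : W.geomTorsion ((2 ^ J : ℕ) : ℤ) ⧸ C),
      ∀ τ : localSubgroup κ.kerSubgroup (v.adicCompletion ℚ),
        ξ.1 (τ : absoluteGaloisGroup (v.adicCompletion ℚ)) =
          Submodule.Quotient.mk (g τ) +
            ((((W.twistedTorsionGaloisModule 2 κ J u hu).restrict
              (absGaloisRestrict ℚ (v.adicCompletion ℚ))).quotient C hCstab)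
                (τ : absoluteGaloisGroup (v.adicCompletion ℚ)) d - d) := by
  -- notation-free abbreviations
  haveI : CompactSpace (absoluteGaloisGroup (v.adicCompletion ℚ)) :=
    absoluteGaloisGroup_compactSpace (v.adicCompletion ℚ)
  haveI hNc : IsClosed ((localSubgroup κ.kerSubgroup (v.adicCompletion ℚ) :
      Subgroup (absoluteGaloisGroup (v.adicCompletion ℚ))) : Set (absoluteGaloisGroup (v.adicCompletion ℚ))) := by
    rw [localSubgroup_eq_comap, Subgroup.coe_comap]
    exact κ.isClosed_kerSubgroup.preimage (map_continuous (resGal (K := ℚ) (v.adicCompletion ℚ)))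
  set R := (W.twistedTorsionGaloisModule 2 κ J u hu).restrict (absGaloisRestrict ℚ (v.adicCompletion ℚ)) with hR
  set D := R.quotient C hCstab with hD
  -- the action of `G_K` on `E[2^J](χ_u)` is the plain one; `γ̃` acts by `u · γ̃`
  have hRG : ∀ (τ : localSubgroup κ.kerSubgroup (v.adicCompletion ℚ)) (m : W.geomTorsion ((2 ^ J : ℕ) : ℤ)),
      R (τ : absoluteGaloisGroup (v.adicCompletion ℚ)) m =
        absGaloisRestrict ℚ (v.adicCompletion ℚ) (τ : absoluteGaloisGroup (v.adicCompletion ℚ)) • m := by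
    intro τ m
    have hτ : absGaloisRestrict ℚ (v.adicCompletion ℚ) (τ : absoluteGaloisGroup (v.adicCompletion ℚ)) ∈
        κ.kerSubgroup := (mem_localSubgroup_iff κ.kerSubgroup (v.adicCompletion ℚ) _).1 τ.2
    change W.twistedTorsionGaloisModule 2 κ J u hu (absGaloisRestrict ℚ (v.adicCompletion ℚ) _) m = _
    erw [ZpExtension.galoisTwist_apply_of_mem_kerSubgroup _ _ _ _ _ _ hτ, torsionGaloisModule_apply_apply]
  have hRγ : ∀ m : W.geomTorsion ((2 ^ J : ℕ) : ℤ),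
      R γt m = u • (absGaloisRestrict ℚ (v.adicCompletion ℚ) γt • m) := by
    intro m
    change W.twistedTorsionGaloisModule 2 κ J u hu (absGaloisRestrict ℚ (v.adicCompletion ℚ) γt) m = _
    erw [ZpExtension.galoisTwist_apply_of_isTopGenerator _ _ _ _ _ _ hγt, torsionGaloisModule_apply_apply]
    rw [WeierstrassCurve.resGal_eq_absGaloisRestrict]
  have hDmk : ∀ (σ : absoluteGaloisGroup (v.adicCompletion ℚ)) (m : W.geomTorsion ((2 ^ J : ℕ) : ℤ)),
      D.toTopRep.ρ σ (Submodule.Quotient.mk m) = Submodule.Quotient.mk (R σ m) := fun _ _ ↦ rfl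
  -- §1 the cocycle `ḡ = g mod C` of `G_K`
  let gb : contOneCocycles (subgroupRep D.toTopRep (localSubgroup κ.kerSubgroup (v.adicCompletion ℚ))) :=
    ⟨⟨fun τ ↦ Submodule.Quotient.mk (g τ),
      (continuous_of_discreteTopology (f := (Submodule.Quotient.mk :
        W.geomTorsion ((2 ^ J : ℕ) : ℤ) → W.geomTorsion ((2 ^ J : ℕ) : ℤ) ⧸ C))).comp hgcont⟩, by
      intro τ₁ τ₂
      change Submodule.Quotient.mk (g (τ₁ * τ₂)) =
        Submodule.Quotient.mk (g τ₁) + D.toTopRep.ρ (τ₁ : absoluteGaloisGroup (v.adicCompletion ℚ))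
          (Submodule.Quotient.mk (g τ₂))
      rw [hDmk, hRG, hgcoc, Submodule.Quotient.mk_add]⟩
  have hgb : ∀ τ, gb.1 τ = Submodule.Quotient.mk (g τ) := fun _ ↦ rfl
  set yc := oneCocycleClass _ gb with hyc
  -- §2 the class of `ḡ` is fixed by `γ̃`
  have hinvγ : conjMap D.toTopRep (localSubgroup κ.kerSubgroup (v.adicCompletion ℚ)) γt 1 yc = yc := by
    rw [hyc, conjMap_oneCocycleClass]
    have h0 : oneCocycleClass _ (contOneCocycles.pullback (subgroupConj _ γt) (conjRepHom D.toTopRep _ γt) gb - gb) =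
        0 := by
      refine (oneCocycleClass_eq_zero_iff _ _).2 ⟨Submodule.Quotient.mk m₀, fun τ ↦ ?_⟩
      rw [Submodule.coe_sub, ContinuousMap.sub_apply, conj_pullback_apply, hgb, hgb]
      change D.toTopRep.ρ γt (Submodule.Quotient.mk _) - _ =
        D.toTopRep.ρ (τ : absoluteGaloisGroup (v.adicCompletion ℚ)) (Submodule.Quotient.mk m₀) - _
      rw [hDmk, hDmk, hRγ, hRG, ← Submodule.Quotient.mk_sub, ← Submodule.Quotient.mk_sub]
      exact (Submodule.Quotient.eq C).2 (hm₀ τ)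
    rwa [oneCocycleClass_sub, sub_eq_zero] at h0
  -- §3 … hence by all of `Γ`
  have hinv : ∀ σ : absoluteGaloisGroup (v.adicCompletion ℚ),
      conjMap D.toTopRep (localSubgroup κ.kerSubgroup (v.adicCompletion ℚ)) σ 1 yc = yc := by
    -- the stabiliser
    let S : Subgroup (absoluteGaloisGroup (v.adicCompletion ℚ)) :=
      { carrier := {σ | conjMap D.toTopRep (localSubgroup κ.kerSubgroup (v.adicCompletion ℚ)) σ 1 yc = yc}
        one_mem' := conjMap_one_one D.toTopRep _ yc
        mul_mem' := fun {a b} ha hb ↦ by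
          change conjMap D.toTopRep _ (a * b) 1 yc = yc
          rw [← conjMap_conjMap, show conjMap D.toTopRep _ b 1 yc = yc from hb]
          exact ha
        inv_mem' := fun {a} ha ↦ by
          change conjMap D.toTopRep _ a⁻¹ 1 yc = yc
          conv_lhs => rw [← show conjMap D.toTopRep _ a 1 yc = yc from ha]
          rw [conjMap_conjMap, inv_mul_cancel, conjMap_one_one] }
    have hS : ∀ σ, σ ∈ S ↔ conjMap D.toTopRep (localSubgroup κ.kerSubgroup (v.adicCompletion ℚ)) σ 1 yc = yc :=
      fun _ ↦ Iff.rfl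
    -- `S` contains an open subgroup, hence is open and closed
    obtain ⟨U, hUo, hU⟩ := exists_isOpen_forall_conjMap_eq (localSubgroup κ.kerSubgroup (v.adicCompletion ℚ)) D yc
    have hUS : U ≤ S := fun σ hσ ↦ (hS σ).2 (hU σ hσ)
    have hSo : IsOpen (S : Set (absoluteGaloisGroup (v.adicCompletion ℚ))) := Subgroup.isOpen_mono hUS hUo
    have hSc : IsClosed (S : Set (absoluteGaloisGroup (v.adicCompletion ℚ))) := Subgroup.isClosed_of_isOpen S hSo
    -- `S ⊇ G_K` and `γ̃ ∈ S`, so `S ⊇ cl⟨γ̃⟩ · G_K = Γ`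
    have hNS : localSubgroup κ.kerSubgroup (v.adicCompletion ℚ) ≤ S := fun n hn ↦
      (hS n).2 (conjMap_eq_self_of_mem_one D.toTopRep _ hn yc)
    have hγS : γt ∈ S := (hS γt).2 hinvγ
    have hclS : (Subgroup.zpowers γt).topologicalClosure ≤ S :=
      Subgroup.topologicalClosure_minimal _ ((Subgroup.zpowers_le (G := absoluteGaloisGroup
        (v.adicCompletion ℚ))).2 hγS) hSc
    intro σ
    obtain ⟨x, hx, hxσ⟩ := exists_mem_closure_zpowers_kappa_eq
      (κ := κ.toContinuousMonoidHom.comp (resGal (K := ℚ) (v.adicCompletion ℚ))) (γp := γt)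
      (by change κ (resGal (K := ℚ) (v.adicCompletion ℚ) γt) = _; exact hγt)
      ((κ.toContinuousMonoidHom.comp (resGal (K := ℚ) (v.adicCompletion ℚ))) σ)
    have hn : x⁻¹ * σ ∈ localSubgroup κ.kerSubgroup (v.adicCompletion ℚ) := by
      rw [localSubgroup_kerSubgroup_eq_ker, MonoidHom.mem_ker, map_mul, map_inv]
      change ((κ.toContinuousMonoidHom.comp (resGal (K := ℚ) (v.adicCompletion ℚ))) x)⁻¹ *
        (κ.toContinuousMonoidHom.comp (resGal (K := ℚ) (v.adicCompletion ℚ))) σ = 1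
      rw [hxσ, inv_mul_cancel]
    have hσS : σ ∈ S := by
      have : x * (x⁻¹ * σ) = σ := mul_inv_cancel_left x σ
      rw [← this]
      exact S.mul_mem (hclS hx) (hNS hn)
    exact (hS σ).1 hσS
  -- §4 extension: `H²(Γ/G_K, D^{G_K}) = 0` (`cd_2 ≤ 1`) and XXXIII
  have hsub : Subsingleton (continuousCohomology 2
      (D.quotientInvariants (localSubgroup κ.kerSubgroup (v.adicCompletion ℚ))).toTopRep) := by
    have hcd := groupCdLE_one_quotient_localSubgroup 2 κ hκ hv2
    refine hcd _ (D.quotientInvariants (localSubgroup κ.kerSubgroup (v.adicCompletion ℚ))) (fun m ↦ ⟨J, ?_⟩)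
      (by norm_num)
    have ht : ∀ t : W.geomTorsion ((2 ^ J : ℕ) : ℤ), 2 ^ J • t = 0 := fun t ↦ Subtype.ext (by
      rw [AddSubmonoidClass.coe_nsmul, ZeroMemClass.coe_zero, ← natCast_zsmul]
      exact (mem_geomTorsion_iff W _ _).1 t.2)
    have hq : ∀ q : W.geomTorsion ((2 ^ J : ℕ) : ℤ) ⧸ C, 2 ^ J • q = 0 := by
      intro q
      induction q using Submodule.Quotient.induction_on with
      | _ t => rw [← Submodule.mkQ_apply, ← map_nsmul, ht, map_zero]
    exact Subtype.ext (by rw [AddSubmonoidClass.coe_nsmul, ZeroMemClass.coe_zero]; exact hq _)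
  obtain ⟨xc, hxc⟩ := @exists_resSubgroup_eq_of_forall_conjMap_eq_of_subsingleton_two _ _ _ _ _ _ _
    (localSubgroup κ.kerSubgroup (v.adicCompletion ℚ)) hNn hNc _ _ _ _ D hsub yc hinv
  -- §5 cocycle-level output
  obtain ⟨ξ, rfl⟩ := oneCocycleClass_surjective _ xc
  rw [resSubgroup_oneCocycleClass, hyc] at hxc
  have h0 : oneCocycleClass _ (contOneCocycles.pullback (subgroupSubtypeHom _)
      (Y := subgroupRep D.toTopRep _) (TopRep.ofHom ⟨ContinuousLinearMap.id ℤ _, fun _ => rfl⟩) ξ - gb) = 0 := by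
    rw [oneCocycleClass_sub, sub_eq_zero]
    exact hxc
  obtain ⟨d, hd⟩ := (oneCocycleClass_eq_zero_iff _ _).1 h0
  refine ⟨ξ, d, fun τ ↦ ?_⟩
  have h := hd τ
  rw [Submodule.coe_sub, ContinuousMap.sub_apply, resSubgroup_pullback_apply, hgb, sub_eq_iff_eq_add'] at h
  rw [h]
  rfl

end Summit.BirchSwinnertonDyer.BirchSwinnertonDyer.Theorems.MultTransportTwistedDescent

end
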